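import Mathlib
import HarnessLib
import Literature.Analysis.FluidPDE.LocalTypeIScaling
import Literature.Analysis.FluidPDE.LocalTypeICongr
import Literature.Analysis.FluidPDE.SuitableWeakCongr
import Literature.Analysis.FluidPDE.SuitableWeakInBallTools
import Literature.Analysis.FluidPDE.ESSLocalHolderBlowupLimit
import Literature.Analysis.FluidPDE.BlowupFarField
import Summits.NavierStokesRegularity.NavierStokesRegularity.Theorems.HardyPointSinkABForwardHardyVertex
import Summits.NavierStokesRegularity.NavierStokesRegularity.Theorems.HardyPointSinkABForwardHardyPointPicking

/-!
# Route HardyPointSink — support `ABForwardHardy` (item stmt-NavierStokesRegularity-7983), file 6: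
# the blow-up sequence at a local Type I singular point

Sixth helper file for the forward direction of Albritton–Barker 2019, Thm. 1.1 (A–B §3,
Seregin–Šverák 2009, §2 before Thm. 2.8: "we scale `v` and `q` … `u^k(y,s) = λ_k v(x,t)`,
`p^k(y,s) = λ_k² q(x,t)`, `x = x^k + λ_k y`, `t = t_k + λ_k² s`, `λ_k = 1/M_k` … (b15) `|u^k| ≤ 1`,
(b16) `|u^k(0,0)| = 1`").  From a suitable weak solution `(u, p)` in the unit parabolic ball with
a backward-singular vertex and a weak gradient `G` we build the **blow-up sequence**
(`exists_approximants`): the clean vertex and the continuous representative of file `…Vertex`,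
the centres `z_k` of file `…PointPicking` at the levels `A = 2ᵏ`, the scales
`λ_k = 1/(2‖u(z_k)‖)` and the Navier–Stokes zooms `v_k = λ_k u(t_k + λ_k² ·, x_k + λ_k ·)`,
`q_k = λ_k² p ∘ Φ_k`, `G_k = λ_k² G ∘ Φ_k`.  Recorded: Albritton–Barker's class Def. 2.1 on the
balls `Q(0, 2ᵐ)`, `m ≤ k`, the weak gradients there, the scale-invariant bound
`𝐈(Q(0, 2ᵐ); v_k) ≤ 𝐈(Q(0, 1); u)`, the pointwise bound `‖v_k‖ ≤ 1` on `Q(0, 2^{k+1})`, the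
normalisation `‖v_k(0, 0)‖ = 1/2`, continuity at the vertex and on `Q(0, 2^{k+1})`, and the
explicit zoom structure (centres, scales, the representative) used later to transport the Hardy
bound.

## References

* D. Albritton, T. Barker, J. Math. Fluid Mech. 21 (2019) = arXiv:1811.00502, §3.
* G. Seregin, V. Šverák, Comm. PDE 34 (2009) = arXiv:0804.1803, §2 (b15)–(b16), Thm. 2.8.
-/

noncomputable section

open MeasureTheory Set Function Filter Topology TopologicalSpace Metric
open scoped NNReal ENNReal
open Literature.Analysis Literature.Analysis.FluidPDE

-- single-problem summit: the namespace repeats the summit name by design (CONVENTIONS §1)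
set_option linter.dupNamespace false

namespace Summit.NavierStokesRegularity.NavierStokesRegularity.Theorems.HardyPointSinkABForwardHardy

/-- The zoom evaluated through `uncurry`. -/
theorem uncurry_smul_stPull {F : Type*} [NormedAddCommGroup F] [NormedSpace ℝ F]
    (a β γ t₀ : ℝ) (x₀ : (EuclideanSpace ℝ (Fin 3))) (f : ℝ → (EuclideanSpace ℝ (Fin 3)) → F) (w : ℝ × (EuclideanSpace ℝ (Fin 3))) :
    uncurry (a • stPull β γ t₀ x₀ f) w = a • uncurry f (stAffine β γ t₀ x₀ w) := by
  cases w
  rfl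

/-- **The blow-up sequence at a local Type I singular point** (Seregin–Šverák 2009, §2,
(b15)–(b16); Albritton–Barker 2019, §3).  See the module docstring for the list of recorded
properties. [cite: SereginSverak2009, §2 Thm 2.8; AlbrittonBarker2019, §3] -/
theorem exists_approximants {u : ℝ → (EuclideanSpace ℝ (Fin 3)) → (EuclideanSpace ℝ (Fin 3))} {p : ℝ → (EuclideanSpace ℝ (Fin 3)) → ℝ} {G : ℝ → (EuclideanSpace ℝ (Fin 3)) → (EuclideanSpace ℝ (Fin 3)) →L[ℝ] (EuclideanSpace ℝ (Fin 3))}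
    (hball : IsSuitableWeakSolutionInBall 1 (0 : ℝ × (EuclideanSpace ℝ (Fin 3))) u p)
    (hwg : HasWeakSpatialGradientOn (parabolicCylinderOpens 1 (0 : ℝ × (EuclideanSpace ℝ (Fin 3)))) u G)
    (hsing : IsBackwardSingularPoint u 0) :
    ∃ (v : ℕ → ℝ → (EuclideanSpace ℝ (Fin 3)) → (EuclideanSpace ℝ (Fin 3))) (q : ℕ → ℝ → (EuclideanSpace ℝ (Fin 3)) → ℝ) (Gz : ℕ → ℝ → (EuclideanSpace ℝ (Fin 3)) → (EuclideanSpace ℝ (Fin 3)) →L[ℝ] (EuclideanSpace ℝ (Fin 3)))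
      (zs : ℕ → ℝ × (EuclideanSpace ℝ (Fin 3))) (lam : ℕ → ℝ) (uh : ℝ → (EuclideanSpace ℝ (Fin 3)) → (EuclideanSpace ℝ (Fin 3))),
      (∀ k, 0 < lam k) ∧
      (∀ᵐ w ∂(volume : Measure (ℝ × (EuclideanSpace ℝ (Fin 3)))), uncurry u w = uncurry uh w) ∧
      (∀ k, v k = lam k • stPull (lam k ^ 2) (lam k) (zs k).1 (zs k).2 uh) ∧
      (∀ k, Icc ((zs k).1 - ((2 : ℝ) ^ (k + 1) * lam k) ^ 2) (zs k).1 ×ˢ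
          closedBall (zs k).2 ((2 : ℝ) ^ (k + 1) * lam k) ⊆ parabolicCylinder 1 (0 : ℝ × (EuclideanSpace ℝ (Fin 3)))) ∧
      (∀ m k : ℕ, m ≤ k → IsSuitableWeakSolutionInBall ((2 : ℝ) ^ m) 0 (v k) (q k)) ∧
      (∀ m k : ℕ, m ≤ k →
        HasWeakSpatialGradientOn (parabolicCylinderOpens ((2 : ℝ) ^ m) (0 : ℝ × (EuclideanSpace ℝ (Fin 3)))) (v k) (Gz k)) ∧
      (∀ m k : ℕ, m ≤ k →
        typeIBound (parabolicCylinder ((2 : ℝ) ^ m) (0 : ℝ × (EuclideanSpace ℝ (Fin 3)))) (v k) (q k) (Gz k) ≤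
          typeIBound (parabolicCylinder 1 (0 : ℝ × (EuclideanSpace ℝ (Fin 3)))) u p G) ∧
      (∀ k, ∀ w ∈ parabolicCylinder ((2 : ℝ) ^ (k + 1)) (0 : ℝ × (EuclideanSpace ℝ (Fin 3))), ‖v k w.1 w.2‖ ≤ 1) ∧
      (∀ k, ‖v k 0 0‖ = 1 / 2) ∧
      (∀ k, ContinuousAt (uncurry (v k)) 0) ∧
      (∀ k, ContinuousOn (uncurry (v k)) (parabolicCylinder ((2 : ℝ) ^ (k + 1)) (0 : ℝ × (EuclideanSpace ℝ (Fin 3))))) := by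
  classical
  obtain ⟨z₀, η, ut, hη, hsub, -, hutc, hute, hub⟩ :=
    exists_clean_vertex_representative hball.1 hsing
  have hmeas : MeasurableSet (parabolicCylinder η z₀) := (isOpen_parabolicCylinder η z₀).measurableSet
  -- ## the modified field `uh = ut` on `Q(z₀, η)`, `= u` elsewhere
  set uh : ℝ → (EuclideanSpace ℝ (Fin 3)) → (EuclideanSpace ℝ (Fin 3)) := fun t x => if (t, x) ∈ parabolicCylinder η z₀ then ut (t, x) else u t x
    with huh
  have huh_eq : ∀ w ∈ parabolicCylinder η z₀, uncurry uh w = ut w := by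
    rintro ⟨t, x⟩ hw
    show uh t x = ut (t, x)
    simp only [huh, if_pos hw]
  have huh_ne : ∀ w ∉ parabolicCylinder η z₀, uncurry uh w = uncurry u w := by
    rintro ⟨t, x⟩ hw
    show uh t x = u t x
    simp only [huh, if_neg hw]
  have hae : ∀ᵐ w ∂(volume : Measure (ℝ × (EuclideanSpace ℝ (Fin 3)))), uncurry u w = uncurry uh w := by
    have h1 : ∀ᵐ w ∂(volume : Measure (ℝ × (EuclideanSpace ℝ (Fin 3)))), w ∈ parabolicCylinder η z₀ → uncurry u w = ut w :=
      (ae_restrict_iff' hmeas).1 hute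
    filter_upwards [h1] with w hw
    by_cases hmem : w ∈ parabolicCylinder η z₀
    · rw [huh_eq w hmem]; exact hw hmem
    · rw [huh_ne w hmem]
  have hae' : ∀ (S : Set (ℝ × (EuclideanSpace ℝ (Fin 3)))), ∀ᵐ w ∂(volume.restrict S), uncurry u w = uncurry uh w :=
    fun S => ae_restrict_of_ae hae
  have huhc : ContinuousOn (uncurry uh) (parabolicCylinder η z₀) :=
    hutc.congr fun w hw => huh_eq w hw
  -- the data transported to `uh`
  have hswh : IsSuitableWeakSolutionOn (parabolicCylinderOpens 1 (0 : ℝ × (EuclideanSpace ℝ (Fin 3)))) 1 0 uh p :=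
    hball.1.congr_ae (hae' _) (ae_of_all _ fun _ => rfl)
  have hwgh : HasWeakSpatialGradientOn (parabolicCylinderOpens 1 (0 : ℝ × (EuclideanSpace ℝ (Fin 3)))) uh G :=
    hwg.congr_ae (hae' _)
  have hIh : typeIBound (parabolicCylinder 1 (0 : ℝ × (EuclideanSpace ℝ (Fin 3)))) uh p G =
      typeIBound (parabolicCylinder 1 (0 : ℝ × (EuclideanSpace ℝ (Fin 3)))) u p G :=
    (typeIBound_congr_ae (p := p) (G := G) (hae' _)).symm
  -- ## the centres (point picking at the levels `A = 2ᵏ`)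
  have hpick : ∀ k : ℕ, ∃ zs : ℝ × (EuclideanSpace ℝ (Fin 3)), zs ∈ parabolicCylinder η z₀ ∧ 1 ≤ ‖ut zs‖ ∧ 0 < ‖ut zs‖ ∧
      Icc (zs.1 - ((2 : ℝ) ^ k / ‖ut zs‖) ^ 2) zs.1 ×ˢ closedBall zs.2 ((2 : ℝ) ^ k / ‖ut zs‖) ⊆
        parabolicCylinder η z₀ ∧
      ∀ w ∈ parabolicCylinder ((2 : ℝ) ^ k / ‖ut zs‖) zs, ‖ut w‖ ≤ 2 * ‖ut zs‖ := fun k =>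
    exists_blowup_centre hη hutc hub (A := (2 : ℝ) ^ k) (by positivity) 1
  choose zs hzsU hzs1 hzs0 hbox hbd2 using hpick
  set Ms : ℕ → ℝ := fun k => ‖ut (zs k)‖ with hMs
  set ρ : ℕ → ℝ := fun k => (2 : ℝ) ^ k / Ms k with hρ
  set lam : ℕ → ℝ := fun k => 1 / (2 * Ms k) with hlamdef
  have hMs0 : ∀ k, 0 < Ms k := hzs0
  have hρ0 : ∀ k, 0 < ρ k := fun k => div_pos (by positivity) (hMs0 k)
  have hlam0 : ∀ k, 0 < lam k := fun k => one_div_pos.2 (mul_pos two_pos (hMs0 k))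
  have hlamρ : ∀ k, (2 : ℝ) ^ (k + 1) * lam k = ρ k := fun k => by
    rw [hρ, hlamdef]; dsimp only
    have := (hMs0 k).ne'
    rw [pow_succ]; field_simp
  have hlamMs : ∀ k, lam k * Ms k = 1 / 2 := fun k => by
    rw [hlamdef]; dsimp only
    have := (hMs0 k).ne'
    field_simp
  -- the geometry of the boxes
  have hboxU : ∀ k, Icc ((zs k).1 - ρ k ^ 2) (zs k).1 ×ˢ closedBall (zs k).2 (ρ k) ⊆
      parabolicCylinder η z₀ := fun k => hbox k
  have hQρU : ∀ k, parabolicCylinder (ρ k) (zs k) ⊆ parabolicCylinder η z₀ := fun k =>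
    (parabolicCylinder_subset_Icc_prod_closedBall (zs k) (ρ k)).trans (hboxU k)
  have hmem_zoom : ∀ k, ∀ w ∈ parabolicCylinder ((2 : ℝ) ^ (k + 1)) (0 : ℝ × (EuclideanSpace ℝ (Fin 3))),
      stAffine (lam k ^ 2) (lam k) (zs k).1 (zs k).2 w ∈ parabolicCylinder (ρ k) (zs k) := by
    intro k w hw
    refine zoom_mem_parabolicCylinder (hlam0 k) (zs k) ?_
    rwa [← hlamρ k, mul_div_cancel_right₀ _ (hlam0 k).ne']
  -- ## the rescaled fields
  set v : ℕ → ℝ → (EuclideanSpace ℝ (Fin 3)) → (EuclideanSpace ℝ (Fin 3)) := fun k => lam k • stPull (lam k ^ 2) (lam k) (zs k).1 (zs k).2 uh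
    with hvdef
  set q : ℕ → ℝ → (EuclideanSpace ℝ (Fin 3)) → ℝ := fun k => lam k ^ 2 • stPull (lam k ^ 2) (lam k) (zs k).1 (zs k).2 p
    with hqdef
  set Gz : ℕ → ℝ → (EuclideanSpace ℝ (Fin 3)) → (EuclideanSpace ℝ (Fin 3)) →L[ℝ] (EuclideanSpace ℝ (Fin 3)) := fun k =>
    lam k ^ 2 • stPull (lam k ^ 2) (lam k) (zs k).1 (zs k).2 G with hGzdef
  -- ## the class Def. 2.1 on `Q(0, 2^{k+1})`
  have hInρ : ∀ k, IsSuitableWeakSolutionInBall (ρ k) (zs k) uh p := fun k =>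
    hswh.isSuitableWeakSolutionInBall ((hboxU k).trans hsub)
  have hIn2 : ∀ k, IsSuitableWeakSolutionInBall ((2 : ℝ) ^ (k + 1)) 0 (v k) (q k) := by
    intro k
    have h1 := (hInρ k).zoom (hρ0 k)
    set c : ℝ := lam k / ρ k with hc
    have hc0 : 0 < c := div_pos (hlam0 k) (hρ0 k)
    have h2 := h1.zoomOut hc0
    have hcρ : c * ρ k = lam k := div_mul_cancel₀ _ (hρ0 k).ne'
    have hrad : 1 / c = (2 : ℝ) ^ (k + 1) := by
      rw [hc, one_div_div, ← hlamρ k, mul_div_cancel_right₀ _ (hlam0 k).ne']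
    rw [zoom_zoom, zoom_zoom, hcρ, hrad, show c ^ 2 * ρ k ^ 2 = lam k ^ 2 by rw [← hcρ]; ring] at h2
    exact h2
  have hballs : ∀ m k : ℕ, m ≤ k → IsSuitableWeakSolutionInBall ((2 : ℝ) ^ m) 0 (v k) (q k) := by
    intro m k hmk
    refine (hIn2 k).of_subset_zero (by positivity) (parabolicCylinder_mono (by positivity) ?_ _)
    exact pow_le_pow_right₀ (by norm_num) (by omega)
  -- ## the weak gradients
  have hpre : ∀ k, parabolicCylinderOpens ((2 : ℝ) ^ (k + 1)) (0 : ℝ × (EuclideanSpace ℝ (Fin 3))) ≤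
      stPreimage (lam k ^ 2) (lam k) (zs k).1 (zs k).2 (parabolicCylinderOpens 1 (0 : ℝ × (EuclideanSpace ℝ (Fin 3)))) :=
    fun k w hw => ((hQρU k).trans hsub) (hmem_zoom k w hw)
  have hgrads : ∀ m k : ℕ, m ≤ k →
      HasWeakSpatialGradientOn (parabolicCylinderOpens ((2 : ℝ) ^ m) (0 : ℝ × (EuclideanSpace ℝ (Fin 3)))) (v k) (Gz k) := by
    intro m k hmk
    have h1 := hwgh.stRescale (lam k) (β := lam k ^ 2) (γ := lam k) (pow_pos (hlam0 k) 2) (hlam0 k)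
      (zs k).1 (zs k).2
    rw [show lam k * lam k = lam k ^ 2 by ring] at h1
    refine h1.mono (le_trans (fun w hw => ?_) (hpre k))
    exact parabolicCylinder_mono (by positivity) (pow_le_pow_right₀ (by norm_num) (by omega)) _ hw
  -- ## the Type I bound
  have hIs : ∀ m k : ℕ, m ≤ k →
      typeIBound (parabolicCylinder ((2 : ℝ) ^ m) (0 : ℝ × (EuclideanSpace ℝ (Fin 3)))) (v k) (q k) (Gz k) ≤
        typeIBound (parabolicCylinder 1 (0 : ℝ × (EuclideanSpace ℝ (Fin 3)))) u p G := by
    intro m k hmk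
    rw [← hIh, ← typeIBound_nsZoom (hlam0 k) (zs k).1 (zs k).2 (parabolicCylinder 1 (0 : ℝ × (EuclideanSpace ℝ (Fin 3)))) uh p G]
    refine typeIBound_mono (fun w hw => hpre k ?_)
    exact parabolicCylinder_mono (by positivity) (pow_le_pow_right₀ (by norm_num) (by omega)) _ hw
  -- ## pointwise bound, vertex value, continuity
  have hbd1 : ∀ k, ∀ w ∈ parabolicCylinder ((2 : ℝ) ^ (k + 1)) (0 : ℝ × (EuclideanSpace ℝ (Fin 3))), ‖v k w.1 w.2‖ ≤ 1 := by
    intro k w hw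
    have hmem := hmem_zoom k w hw
    have hval : v k w.1 w.2 = lam k • uncurry uh (stAffine (lam k ^ 2) (lam k) (zs k).1 (zs k).2 w) := by
      rw [← uncurry_smul_stPull]; rfl
    rw [hval, huh_eq _ (hQρU k hmem), norm_smul, Real.norm_of_nonneg (hlam0 k).le]
    calc lam k * ‖ut (stAffine (lam k ^ 2) (lam k) (zs k).1 (zs k).2 w)‖
        ≤ lam k * (2 * Ms k) := mul_le_mul_of_nonneg_left (hbd2 k _ hmem) (hlam0 k).le
      _ = 1 := by rw [← mul_assoc, mul_comm (lam k) 2, mul_assoc, hlamMs]; norm_num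
  have hst0 : ∀ k, stAffine (lam k ^ 2) (lam k) (zs k).1 (zs k).2 0 = zs k := fun k => by
    rw [show (0 : ℝ × (EuclideanSpace ℝ (Fin 3))) = ((0 : ℝ), (0 : (EuclideanSpace ℝ (Fin 3)))) from rfl, stAffine_apply, mul_zero, add_zero,
      smul_zero, add_zero]
  have hvtx : ∀ k, ‖v k 0 0‖ = 1 / 2 := by
    intro k
    have hval : v k 0 0 = lam k • uncurry uh (stAffine (lam k ^ 2) (lam k) (zs k).1 (zs k).2 0) := by
      rw [← uncurry_smul_stPull]; rfl
    rw [hval, hst0, huh_eq _ (hzsU k), norm_smul, Real.norm_of_nonneg (hlam0 k).le]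
    exact hlamMs k
  have hcomp : ∀ k, uncurry (v k) =
      fun w => lam k • (uncurry uh ∘ stAffine (lam k ^ 2) (lam k) (zs k).1 (zs k).2) w :=
    fun k => funext fun w => uncurry_smul_stPull _ _ _ _ _ _ _
  have hcontAt : ∀ k, ContinuousAt (uncurry (v k)) 0 := by
    intro k
    rw [hcomp k]
    have h1 : ContinuousAt (uncurry uh ∘ stAffine (lam k ^ 2) (lam k) (zs k).1 (zs k).2) 0 := by
      refine ContinuousAt.comp ?_ (continuous_stAffine _ _ _ _).continuousAt
      rw [hst0]
      exact huhc.continuousAt ((isOpen_parabolicCylinder η z₀).mem_nhds (hzsU k))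
    exact h1.const_smul (lam k)
  have hcontOn : ∀ k, ContinuousOn (uncurry (v k)) (parabolicCylinder ((2 : ℝ) ^ (k + 1)) (0 : ℝ × (EuclideanSpace ℝ (Fin 3)))) := by
    intro k
    rw [hcomp k]
    have h1 : ContinuousOn (uncurry uh ∘ stAffine (lam k ^ 2) (lam k) (zs k).1 (zs k).2)
        (parabolicCylinder ((2 : ℝ) ^ (k + 1)) (0 : ℝ × (EuclideanSpace ℝ (Fin 3)))) :=
      huhc.comp (continuous_stAffine _ _ _ _).continuousOn fun w hw => hQρU k (hmem_zoom k w hw)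
    exact h1.const_smul (lam k)
  -- ## conclusion
  refine ⟨v, q, Gz, zs, lam, uh, hlam0, hae, fun k => rfl, fun k => ?_, hballs, hgrads, hIs, hbd1,
    hvtx, hcontAt, hcontOn⟩
  rw [hlamρ k]
  exact (hboxU k).trans hsub

end Summit.NavierStokesRegularity.NavierStokesRegularity.Theorems.HardyPointSinkABForwardHardy

end
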